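import Literature.NumberTheory.GelbartRogawski1991.Sec5
import HarnessLib

/-!
# Gelbart–Rogawski 1991, §5 (pp. 465–468): the kernel-checkable implications among the §5 carpet rows, PROVED

Sibling PROOF file of the statement carpet ★ `Literature/NumberTheory/GelbartRogawski1991/Sec5.lean` (squad TG, cell
hodgecm-mathlib; squad RULING 5 shape: theorems only, hypotheses = ★ named facts, conclusions over ★ sockets; carpets
stay theorem-free).  Nothing here is a new statement of the paper: each theorem records a logical dependency that the
printed text itself asserts or uses, so that a consumer holding the hypotheses does not have to ASSUME the conclusion.

* `remarkP465_of_thm511` — the Remark of p. 465 L23–28 («for fixed `γ`, the set of theta-liftings of `χ` … coincides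
  with the `A`-packet `Π(ϱ)`, `ϱ = (ϱ₂ ∘ det) × ϱ₁`, `ϱ₂(z/z̄) = μ⁻¹γ(z)`, `ϱ₁ = χ(γ¹)⁻¹`») IS Theorem 5.1.1 read through
  the correspondence (5.1.1) `ρ = (η, η′) ↦ (γ, χ) = (μη_Eη′_E, γ¹η′)`: ★ `Sec5.remarkP465 X` follows from ★
  `GR91Spectrum.weil_discrete` (Prop. 3.4.1), ★ `GR91Spectrum.thm34a` (Thm. 3.4 (a)) and ★ `GR91Spectrum.thm511`
  (Thm. 5.1.1) via ★ `GR91Spectrum.discreteMembers_eq`, by group algebra in `X.Char1` (squad QA T-ref3, standing remark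
  (v) «remarkP465 K-reducible»).
* `occursAll_and_L_ne_zero_of_thetaU1Nonzero` — the step of the proof of Cor. 5.2.2 (p. 467 L38–41 with L12–17): by
  PROPOSITION 5.2.1 applied to `χγ¹` ((2) ⇔ (1) ⇔ (3), contrapositive), a NON-ZERO theta lift `θ¹(γ, ψ, χ)` forces
  «`χ_v` occurs in `ω¹(γ_v, ψ_v)` for all `v`» AND `L(½, γ³(χγ¹)_E⁻¹) ≠ 0` (printed: «This last condition is equivalent to
  `L(½, γχ_E⁻¹) ≠ 0`, since `(γ¹)_E = γ²`» — that identity of Hecke characters is not a field of the datum, so the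
  `L`-value is left in the form Prop. 5.2.1 gives it).
* `occursU1_of_thetaU1Nonzero` — with the Howe-lift sentence ★ `Sec5.howeLiftP467` («a Howe lift is defined globally if
  and only if it is defined locally everywhere», p. 467 L33–37): a non-zero `θ¹(γ, ψ, χ)` makes `χ` occur in `ω¹(γ, ψ)`
  globally.
* `eps_eq_one_of_L_ne_zero` — coherence of COROLLARY 5.2.2 with Remarks (1) p. 468 («there exists a `ψ` such that `χ_v`
  "occurs" in `ω¹(γ_v, ψ_v)` for all `v` if and only if `ε(½, γχ_E⁻¹) = +1`», shown in [R₂]): together with Prop. 5.2.1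
  they yield `L(½, γχ_E⁻¹) ≠ 0 ⇒ ε(½, γχ_E⁻¹) = +1` — the expected consequence of the functional equation, obtained here
  from the three printed statements alone (a consistency check of the carpet's typing of the three rows).

THEOREMS ONLY (no definition, no named fact, no instance, no notation, no `sorry`); imports ★ `Sec5` only.

## References
* [GelbartRogawski1991] S. Gelbart, J. Rogawski, *L-functions and Fourier–Jacobi coefficients for the unitary group
  `U(3)`*, Invent. Math. 105 (1991) 445–472: §5.1 p. 465 L23–28 (Remark after Thm. 5.1.1), §5.2 p. 467 L12–17
  (Prop. 5.2.1), L33–37 (Howe lift), L38–41 (Cor. 5.2.2), p. 468 L1–3 (Remarks (1)).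
-/

namespace Literature.NumberTheory.GelbartRogawski1991.Sec5Proofs

open Literature.NumberTheory.GelbartRogawski1991.Sec5
open Sec1Defs (EndoscopicLData)
open Sec5Defs (ThetaLiftData)

universe u

variable {X : GR91Spectrum.{u}} {HeckeE HeckeF : Type u} [CommGroup HeckeE] [CommGroup HeckeF]

/-- **Remark p. 465 ⇐ Theorem 5.1.1** (★ `Sec5.remarkP465`, derived): for `ϱ₂ • μ = γ` («`ϱ₂(z/z̄) = μ⁻¹γ(z)`») and
`ϱ₁ = χ(γ¹)⁻¹`, the packet index of `ϱ = (ϱ₂ ∘ det) × ϱ₁` is `(η, η′) = (ϱ₂ϱ₁⁻¹, ϱ₁)`, for which (5.1.1) returns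
`μη_Eη′_E = ϱ₂ • μ = γ` (★ `gammaOf`) and `γ¹η′ = χ` (★ `chiOf`); so ★ `GR91Spectrum.discreteMembers_eq` (from
`weil_discrete`, `thm34a`, `thm511`) is literally the asserted equality of sets.
[cite: GelbartRogawski1991, §5.1 Remark after Thm. 5.1.1 (p. 465 L23–28); Thm. 5.1.1 (p. 465)] -/
theorem remarkP465_of_thm511 (hdisc : X.weil_discrete) (h34 : X.thm34a) (h511 : X.thm511) :
    remarkP465 X := by
  intro γ χ ϱ₂ hϱ
  have hγ : X.gammaOf (ϱ₂ * (χ * (X.res1 γ)⁻¹)⁻¹) (χ * (X.res1 γ)⁻¹) = γ := by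
    rw [GR91Spectrum.gammaOf, inv_mul_cancel_right, hϱ]
  have hχ : X.chiOf (ϱ₂ * (χ * (X.res1 γ)⁻¹)⁻¹) (χ * (X.res1 γ)⁻¹) = χ := by
    rw [GR91Spectrum.chiOf, hγ, mul_comm, inv_mul_cancel_right]
  have h := X.discreteMembers_eq hdisc h34 h511 (ϱ₂ * (χ * (X.res1 γ)⁻¹)⁻¹) (χ * (X.res1 γ)⁻¹)
  rw [hγ, hχ] at h
  exact h

variable (D : EndoscopicLData X HeckeE HeckeF) (T : ThetaLiftData X)

/-- **Proof of Cor. 5.2.2, first step** (from ★ `Sec5.prop521`): if the theta lift `θ¹(γ, ψ, χ)` is non-zero, then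
`χ_v` occurs in `ω¹(γ_v, ψ_v)` at every place `v` and `L(½, γ³(χγ¹)_E⁻¹) ≠ 0` — Proposition 5.2.1 at the character
`χγ¹` (so that `(χγ¹)(γ¹)⁻¹ = χ`): (2) fails, hence (1) fails, hence (3) fails.
[cite: GelbartRogawski1991, Prop. 5.2.1 (p. 467 L12–17); Cor. 5.2.2 (p. 467 L38–41)] -/
theorem occursAll_and_L_ne_zero_of_thetaU1Nonzero (h521 : prop521 D T) (γ : X.OmegaHecke) (ψ : X.AddChar)
    (χ : X.Char1) (hθ : T.ThetaU1Nonzero γ ψ χ) :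
    (∀ v : D.Place, occursU1At D v γ ψ χ) ∧
      D.LHecke (D.ofOmega γ ^ 3 * (D.bc1 (χ * X.res1 γ))⁻¹) (1 / 2) ≠ 0 := by
  obtain ⟨h12, h13⟩ := h521 γ ψ (χ * X.res1 γ)
  have hχ : χ * X.res1 γ * (X.res1 γ)⁻¹ = χ := mul_inv_cancel_right χ (X.res1 γ)
  simp only [hχ] at h12 h13
  have hnc : ¬ D.IsCuspidal (X.weil γ ψ (χ * X.res1 γ)) := fun hc => (h12.1 hc) hθ
  have h3 : ¬ ((∃ v : D.Place, ¬ occursU1At D v γ ψ χ) ∨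
      D.LHecke (D.ofOmega γ ^ 3 * (D.bc1 (χ * X.res1 γ))⁻¹) (1 / 2) = 0) := fun h => hnc (h13.2 h)
  refine ⟨fun v => ?_, fun h0 => h3 (Or.inr h0)⟩
  by_contra hv
  exact h3 (Or.inl ⟨v, hv⟩)

/-- **A non-zero theta lift is a globally defined Howe lift** (from ★ `Sec5.prop521` and ★ `Sec5.howeLiftP467`): if
`θ¹(γ, ψ, χ) ≠ 0` then `χ` occurs in `ω¹(γ, ψ)` (globally) — local occurrence everywhere (previous theorem) and «a Howe
lift is defined globally if and only if it is defined locally everywhere».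
[cite: GelbartRogawski1991, §5.2 (p. 467 L33–41)] -/
theorem occursU1_of_thetaU1Nonzero (h521 : prop521 D T) (hHowe : howeLiftP467 D T) (γ : X.OmegaHecke)
    (ψ : X.AddChar) (χ : X.Char1) (hθ : T.ThetaU1Nonzero γ ψ χ) : T.OccursU1 γ ψ χ :=
  (hHowe γ ψ χ).2 (occursAll_and_L_ne_zero_of_thetaU1Nonzero D T h521 γ ψ χ hθ).1

/-- **Cor. 5.2.2 + Prop. 5.2.1 + Remarks (1) p. 468 ⇒ `L(½, γχ_E⁻¹) ≠ 0 → ε(½, γχ_E⁻¹) = +1`**: by Cor. 5.2.2 a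
non-vanishing central value gives a `ψ` with `θ¹(γ, ψ, χ) ≠ 0`; by Prop. 5.2.1 `χ_v` then occurs in `ω¹(γ_v, ψ_v)` for
all `v`; by the criterion of [R₂] quoted in Remarks (1) this happens iff `ε(½, γχ_E⁻¹) = +1`.
[cite: GelbartRogawski1991, Cor. 5.2.2 (p. 467 L38–41); Prop. 5.2.1 (p. 467 L12–17); §5.2 Remarks (1) (p. 468 L1–3)] -/
theorem eps_eq_one_of_L_ne_zero (h521 : prop521 D T) (h522 : cor522 D T) (h468 : remarkP468a D)
    (χ : X.Char1) (γ : X.OmegaHecke) (hL : D.LHecke (D.ofOmega γ * (D.bc1 χ)⁻¹) (1 / 2) ≠ 0) :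
    D.eps (D.ofOmega γ * (D.bc1 χ)⁻¹) (1 / 2) = 1 := by
  obtain ⟨ψ, hθ⟩ := (h522 χ γ).1.2 hL
  exact (h468 χ γ).1 ⟨ψ, (occursAll_and_L_ne_zero_of_thetaU1Nonzero D T h521 γ ψ χ hθ).1⟩

end Literature.NumberTheory.GelbartRogawski1991.Sec5Proofs
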